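import Summits.Ventures.PercRepro.ProfilePointedCircuitClassesStarSharpD0N

/-!
# PercRepro — CASE D0 OF `StarNineSharp`, PART O: RULE R3′ (OPPOSITE VERTEX OR ENDPOINT) IS INJECTIVE
(p5, gen 54; `proofs/P5-GM1.md` §81 ADD 1)

In the regime «no ON line through `e`, no ON plane through `e, f`», an ON demand `π + e + b` whose complement
`X ∖ π` is ON is sent to `{e, f, z} + b` where `z` is the third point of the demand plane when it is an OFF C-point
(`r3'Point`, first branch) and an OFF C-endpoint of `π` otherwise (`r3_point_exists'`).  Two demands with the same
image lie in one plane (`same_plane_of_share`), whose trace on `X` has ≤ 3 points (`trace_le_three`); the cases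
opposite/opposite (`π₁ = π₂`), opposite/endpoint (L3 makes the other demand's opposite vertex an OFF C-point) and
endpoint/endpoint (L2 + L1 make the opposite vertices OFF C-points) are each impossible: **`d0_injR3'`**.
-/

open scoped Matroid

namespace PercRepro.Cogirth

open Finset ThmH Skew Shadow Profile

open Classical

variable {α : Type} [DecidableEq α] {N : Matroid α} [N.Finite]

section StarSharpD0O

variable {b b' : α}

/-- `insert t (Y ∪ {b, b'}) = insert b (insert b' (insert t Y))`. -/
theorem insert_union_bb'_eq' (b b' t : α) (Y : Finset α) :
    insert t (Y ∪ {b, b'}) = insert b (insert b' (insert t Y)) := by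
  ext w; simp only [mem_insert, mem_union, mem_singleton]; tauto

/-- `Y ∪ {b, b'} = insert b (insert b' Y)`. -/
theorem union_bb'_eq' (b b' : α) (Y : Finset α) : Y ∪ {b, b'} = insert b (insert b' Y) := by
  ext w; simp only [mem_insert, mem_union, mem_singleton]; tauto

/-- A point in the closure of an ON set keeps it ON. -/
theorem on_insert_of_rk_insert_eq {Y : Finset α} {t : α} (hY : rk N (insert t Y) = rk N Y)
    (hon : rk N (insert b (insert b' Y)) = 4) : rk N (insert b (insert b' (insert t Y))) = 4 := by
  have := rk_insert_union_eq_of_rk_insert_eq' (N := N) (T := {b, b'}) hY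
  rw [insert_union_bb'_eq', union_bb'_eq'] at this
  rw [this, hon]

/-- `insert e (insert z (π₁ ∪ π₂)) ⊆ insert z (insert e π₁) ∪ insert z (insert e π₂)`. -/
theorem insert_e_insert_z_union_subset (e z : α) (π₁ π₂ : Finset α) :
    insert e (insert z (π₁ ∪ π₂)) ⊆ insert z (insert e π₁) ∪ insert z (insert e π₂) := by
  intro w hw; simp only [mem_insert, mem_union] at hw ⊢; tauto

/-- `insert z ((X ∖ {z, y}).erase x) = X ∖ {x, y}` for `z ∈ X`, `z ≠ x`. -/
theorem insert_sdiff_erase_eq {X : Finset α} {x y z : α} (hz : z ∈ X) (hzx : z ≠ x) (hzy : z ≠ y) :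
    insert z ((X \ {z, y}).erase x) = X \ {x, y} := by
  ext w
  simp only [mem_insert, mem_erase, mem_sdiff, mem_singleton, not_or]
  constructor
  · rintro (rfl | ⟨hwx, hwX, hwz, hwy⟩)
    · exact ⟨hz, hzx, hzy⟩
    · exact ⟨hwX, hwx, hwy⟩
  · rintro ⟨hwX, hwx, hwy⟩
    by_cases hwz : w = z
    · exact Or.inl hwz
    · exact Or.inr ⟨hwx, hwX, hwz, hwy⟩

/-- `(X ∖ {z, y₁}).erase y₂ = (X.erase z) ∖ {y₁, y₂}`. -/
theorem sdiff_pair_erase_eq (X : Finset α) (z y₁ y₂ : α) :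
    (X \ {z, y₁}).erase y₂ = (X.erase z) \ {y₁, y₂} := by
  ext w
  simp only [mem_erase, mem_sdiff, mem_insert, mem_singleton, not_or]
  tauto

/-- `insert x (insert e π₂) ⊆ insert z (insert e π₁) ∪ insert e π₂` when `x ∈ π₁`. -/
theorem insert_x_subset_union {π₁ π₂ : Finset α} {e x z : α} (hx : x ∈ π₁) :
    insert x (insert e π₂) ⊆ insert z (insert e π₁) ∪ insert e π₂ := by
  intro w hw
  simp only [mem_insert, mem_union] at hw ⊢
  rcases hw with rfl | rfl | hw
  · exact Or.inl (Or.inr (Or.inr hx))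
  · exact Or.inr (Or.inl rfl)
  · exact Or.inr (Or.inr hw)

/-- `insert y₂ (insert e π₁) ⊆ insert z (insert e π₁) ∪ insert z (insert e π₂)` when `y₂ ∈ π₂`. -/
theorem insert_y_subset_union {π₁ π₂ : Finset α} {e y₂ z : α} (hy : y₂ ∈ π₂) :
    insert y₂ (insert e π₁) ⊆ insert z (insert e π₁) ∪ insert z (insert e π₂) := by
  intro w hw
  simp only [mem_insert, mem_union] at hw ⊢
  rcases hw with rfl | rfl | hw
  · exact Or.inr (Or.inr (Or.inr hy))
  · exact Or.inl (Or.inr (Or.inl rfl))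
  · exact Or.inl (Or.inr (Or.inr hw))

/-- The R3′ point of an ON demand `W`. -/
noncomputable def r3'Point (N : Matroid α) [N.Finite] (b b' e f : α) (W : Finset α) : α :=
  if h : ∃ t ∈ ((((gr N).erase b).erase b').erase f).erase e \ (W.erase b).erase e,
      rk N (insert t (insert e ((W.erase b).erase e))) = 3 ∧ rk N {e, f, t} = 3 ∧
      rk N ((((((gr N).erase b).erase b').erase f).erase e).erase t) = 4 ∧ rk N (insert b (insert b' {e, f, t})) = 5 then h.choose
  else if h' : ∃ x ∈ (W.erase b).erase e, rk N {e, f, x} = 3 ∧ rk N ((((((gr N).erase b).erase b').erase f).erase e).erase x) = 4 ∧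
      rk N (insert b (insert b' {e, f, x})) = 5 then h'.choose
  else e

/-- **RULE R3′ IS INJECTIVE.** -/
theorem d0_injR3' (hn : (gr N).card = 9) (hR : rk N (gr N) = 5)
    (hcf : ∀ x ∈ gr N, rk N ((gr N).erase x) = 5) (h : SeriesPair N b b')
    {e f : α} (he : e ∈ gr N) (hf : f ∈ gr N) (hef : e ≠ f) (heb : e ≠ b) (heb' : e ≠ b') (hfb : f ≠ b) (hfb' : f ≠ b')
    (hE7 : rk N (((gr N).erase b).erase b') = 4)
    (hnle : ∀ S : Finset α, S ⊆ ((gr N).erase b).erase b' → e ∈ S → rk N (insert b (insert b' S)) ≤ 3 → rk N S ≤ 1)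
    (he1 : ∀ y ∈ ((((gr N).erase b).erase b').erase f).erase e, rk N {e, y} = 2)
    (hfc : ∀ y ∈ ((((gr N).erase b).erase b').erase f).erase e, rk N (((((gr N).erase b).erase b').erase f).erase y) = 4)
    (hX : rk N (((((gr N).erase b).erase b').erase f).erase e) = 4) :
    ((d0DON N b' e f).filter (fun W => (¬ d0c0 N b b' e f W ∧ d0c1 N b e f W) ∧ ¬ d0c2 N b b' e f W)).card ≤
      ((biIndepSets N 4).filter (fun W => (f ∈ W ∧ b' ∉ W) ∧ (e ∈ W ∧ b ∈ W ∧ (gr N \ W).erase b' ∈ biIndepSets N 4))).card := by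
  have hb' : b' ∈ gr N := h.2.1; have hbb' : b ≠ b' := h.2.2.1
  have hXE : ((((gr N).erase b).erase b').erase f).erase e ⊆ ((gr N).erase b).erase b' := (erase_subset _ _).trans (erase_subset _ _)
  have hXg : ((((gr N).erase b).erase b').erase f).erase e ⊆ gr N := hXE.trans ((erase_subset _ _).trans (erase_subset _ _))
  have heE : e ∈ ((gr N).erase b).erase b' := mem_erase.2 ⟨heb', mem_erase.2 ⟨heb, he⟩⟩
  have hfE : f ∈ ((gr N).erase b).erase b' := mem_erase.2 ⟨hfb', mem_erase.2 ⟨hfb, hf⟩⟩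
  have heX : e ∉ ((((gr N).erase b).erase b').erase f).erase e := fun h' => (mem_erase.1 h').1 rfl
  have hfX : f ∉ ((((gr N).erase b).erase b').erase f).erase e := fun h' => (mem_erase.1 (mem_erase.1 h').2).1 rfl
  have hdata : ∀ {W : Finset α}, _ := fun {W} => r3'_data hn hR hcf h he hf hef heb heb' hfb hfb' hE7 hnle he1 hfc hX (W := W)
  set X := ((((gr N).erase b).erase b').erase f).erase e with hXdef
  -- the image of a demand is a bi-independent set `{e, f, z} + b` with `z ∈ X`
  have himg : ∀ W ∈ biIndepSets N 4, ((e ∈ W ∧ f ∉ W) ∧ b' ∉ W) → ¬ (gr N \ W).erase b' ∈ biIndepSets N 4 →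
      (¬ d0c0 N b b' e f W ∧ d0c1 N b e f W) → ¬ d0c2 N b b' e f W →
      r3'Point N b b' e f W ∈ X ∧ rk N {e, f, r3'Point N b b' e f W} = 3 ∧
        rk N (X.erase (r3'Point N b b' e f W)) = 4 ∧ rk N (insert b (insert b' {e, f, r3'Point N b b' e f W})) = 5 := by
    intro W hWs hPD hcW ⟨hnc₀, hc1⟩ hnc₂
    obtain ⟨hbW, hπX, hπ2, hYeq, hWeq, hYr, hYc, hYon, hf4, hcon⟩ := hdata hWs hPD hcW hc1 hnc₂
    simp only [r3'Point]
    split_ifs with h1 h2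
    · obtain ⟨ht, h3, h4, h5, h6⟩ := h1.choose_spec
      exact ⟨(mem_sdiff.1 ht).1, h4, h5, h6⟩
    · obtain ⟨hx, h4, h5, h6⟩ := h2.choose_spec
      exact ⟨hπX hx, h4, h5, h6⟩
    · exfalso
      obtain ⟨x, hx, h4, h5, h6⟩ := r3_point_exists' h hn hR hnle he hf hef heb heb' hfb hfb' he1 hX hπX hπ2 hYc hYon
        hf4 hcon
      exact h2 ⟨x, hx, h4, h5, h6⟩
  apply card_le_card_of_injOn (fun W => insert b {e, f, r3'Point N b b' e f W})
  · intro W hW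
    simp only [d0DON, mem_coe, mem_filter] at hW
    obtain ⟨⟨hWs, hPD, hcW⟩, ⟨hnc₀, hc1⟩, hnc₂⟩ := hW
    obtain ⟨hzX, hefz, hz4, hzoff⟩ := himg W hWs hPD hcW ⟨hnc₀, hc1⟩ hnc₂
    set z := r3'Point N b b' e f W with hzdef
    have hze : z ≠ e := fun h' => heX (h' ▸ hzX)
    have hzf : z ≠ f := fun h' => hfX (h' ▸ hzX)
    have hzE := hXE hzX
    have hS : ({e, f, z} : Finset α) ⊆ ((gr N).erase b).erase b' := by
      intro w hw; simp only [mem_insert, mem_singleton] at hw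
      rcases hw with rfl | rfl | rfl <;> assumption
    have hS3' : ({e, f, z} : Finset α).card = 3 := by
      rw [card_insert_of_notMem, card_pair hzf.symm]
      simp only [mem_insert, mem_singleton, not_or]; exact ⟨hef, hze.symm⟩
    simp only [mem_coe, mem_filter]
    refine ⟨?_, ⟨mem_insert_of_mem (mem_insert_of_mem (mem_insert_self _ _)), ?_⟩,
      mem_insert_of_mem (mem_insert_self _ _), mem_insert_self _ _, ?_⟩
    · rw [insert_b_mem_biIndepSets_iff h hn hS hS3', E7_sdiff_efx_eq]
      exact ⟨hefz, hz4⟩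
    · intro h'
      simp only [mem_insert, mem_singleton] at h'
      rcases h' with h2 | h2 | h2 | h2
      · exact hbb' h2.symm
      · exact heb' h2.symm
      · exact hfb' h2.symm
      · exact (mem_erase.1 hzE).1 h2.symm
    · exact (off_image_efx_iff h hn he hf hef heb heb' hfb hfb' hzX).2 ⟨hz4, hzoff⟩
  · intro W₁ hW₁ W₂ hW₂ heq
    simp only [d0DON, mem_coe, mem_filter] at hW₁ hW₂
    obtain ⟨hb₁, hπ₁, hπ2₁, hYeq₁, hWeq₁, hYr₁, hYc₁, hYon₁, hf4₁, hcon₁⟩ := hdata hW₁.1.1 hW₁.1.2.1 hW₁.1.2.2 hW₁.2.1.2 hW₁.2.2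
    obtain ⟨hb₂, hπ₂, hπ2₂, hYeq₂, hWeq₂, hYr₂, hYc₂, hYon₂, hf4₂, hcon₂⟩ := hdata hW₂.1.1 hW₂.1.2.1 hW₂.1.2.2 hW₂.2.1.2 hW₂.2.2
    obtain ⟨hz₁X, -, hz4₁, -⟩ := himg W₁ hW₁.1.1 hW₁.1.2.1 hW₁.1.2.2 hW₁.2.1 hW₁.2.2
    have hz₁e : r3'Point N b b' e f W₁ ≠ e := fun h' => heX (h' ▸ hz₁X)
    have hz₁f : r3'Point N b b' e f W₁ ≠ f := fun h' => hfX (h' ▸ hz₁X)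
    have hz₁b : r3'Point N b b' e f W₁ ≠ b := fun h' => (mem_erase.1 (mem_erase.1 (hXE hz₁X)).2).1 h'
    have hzz : r3'Point N b b' e f W₁ = r3'Point N b b' e f W₂ := by
      have : r3'Point N b b' e f W₁ ∈ insert b ({e, f, r3'Point N b b' e f W₂} : Finset α) := by
        simp only at heq
        rw [← heq]; exact mem_insert_of_mem (mem_insert_of_mem (mem_insert_of_mem (mem_singleton_self _)))
      simp only [mem_insert, mem_singleton] at this
      rcases this with h' | h' | h' | h'
      · exact absurd h' hz₁b
      · exact absurd h' hz₁e
      · exact absurd h' hz₁f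
      · exact h'
    by_cases hππ : (W₁.erase b).erase e = (W₂.erase b).erase e
    · rw [← hWeq₁, ← hWeq₂, ← hYeq₁, ← hYeq₂, hππ]
    · exfalso
      set π₁ := (W₁.erase b).erase e with hπ₁def
      set π₂ := (W₂.erase b).erase e with hπ₂def
      set z := r3'Point N b b' e f W₁ with hzdef
      have hR0₁ : ¬ (rk N (insert f π₁) = 3 ∧ rk N (insert e (X \ π₁)) = 4 ∧
          rk N (insert b (insert b' (insert f π₁))) = 4) := hW₁.2.1.1
      have hR0₂ : ¬ (rk N (insert f π₂) = 3 ∧ rk N (insert e (X \ π₂)) = 4 ∧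
          rk N (insert b (insert b' (insert f π₂))) = 4) := hW₂.2.1.1
      -- a demand in the endpoint branch: its point is an endpoint
      have hend : ∀ W : Finset α, ¬ (∃ t ∈ X \ (W.erase b).erase e, rk N (insert t (insert e ((W.erase b).erase e))) = 3 ∧
          rk N {e, f, t} = 3 ∧ rk N (X.erase t) = 4 ∧ rk N (insert b (insert b' {e, f, t})) = 5) →
          (∃ x ∈ (W.erase b).erase e, rk N {e, f, x} = 3 ∧ rk N (X.erase x) = 4 ∧
            rk N (insert b (insert b' {e, f, x})) = 5) →
          r3'Point N b b' e f W ∈ (W.erase b).erase e := by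
        intro W hno hex
        simp only [r3'Point]
        rw [dif_neg hno, dif_pos hex]
        exact hex.choose_spec.1
      have hopp : ∀ W : Finset α, (hex : ∃ t ∈ X \ (W.erase b).erase e,
          rk N (insert t (insert e ((W.erase b).erase e))) = 3 ∧
          rk N {e, f, t} = 3 ∧ rk N (X.erase t) = 4 ∧ rk N (insert b (insert b' {e, f, t})) = 5) →
          r3'Point N b b' e f W ∈ X \ (W.erase b).erase e ∧
            rk N (insert (r3'Point N b b' e f W) (insert e ((W.erase b).erase e))) = 3 := by
        intro W hex
        simp only [r3'Point]
        rw [dif_pos hex]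
        exact ⟨hex.choose_spec.1, hex.choose_spec.2.1⟩
      have hex₁ := r3_point_exists' h hn hR hnle he hf hef heb heb' hfb hfb' he1 hX hπ₁ hπ2₁ hYc₁ hYon₁ hf4₁ hcon₁
      have hex₂ := r3_point_exists' h hn hR hnle he hf hef heb heb' hfb hfb' he1 hX hπ₂ hπ2₂ hYc₂ hYon₂ hf4₂ hcon₂
      -- the common plane
      have hS₁E : insert e π₁ ⊆ ((gr N).erase b).erase b' := insert_subset heE (hπ₁.trans hXE)
      have hS₂E : insert e π₂ ⊆ ((gr N).erase b).erase b' := insert_subset heE (hπ₂.trans hXE)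
      -- `z` in both closures ⇒ one plane; the trace `π₁ ∪ π₂ ∪ {z}` has ≤ 3 points
      have hsame : rk N (insert z (insert e π₁)) = 3 → rk N (insert z (insert e π₂)) = 3 →
          rk N (insert z (insert e π₁) ∪ insert z (insert e π₂)) ≤ 3 := by
        intro h1 h2
        have hon₁ : rk N (insert b (insert b' (insert z (insert e π₁)))) = 4 :=
          on_insert_of_rk_insert_eq (by rw [h1, hYr₁]) hYon₁
        have hon₂ : rk N (insert b (insert b' (insert z (insert e π₂)))) = 4 :=
          on_insert_of_rk_insert_eq (by rw [h2, hYr₂]) hYon₂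
        exact same_plane_of_share h hR hnle hE7 he1 (insert_subset (hXE hz₁X) hS₁E) (insert_subset (hXE hz₁X) hS₂E)
          (mem_insert_of_mem (mem_insert_self _ _)) (mem_insert_of_mem (mem_insert_self _ _)) hon₁ hon₂ hz₁X
          (mem_insert_self _ _) (mem_insert_self _ _)
      have htrace : rk N (insert z (insert e π₁) ∪ insert z (insert e π₂)) ≤ 3 → (insert z (π₁ ∪ π₂)).card ≤ 3 := by
        intro hU
        apply trace_le_three hn h he hf hef heb heb' hfb hfb' hfc hX (insert_subset hz₁X (union_subset hπ₁ hπ₂))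
        exact (rk_mono' (M := N) (insert_e_insert_z_union_subset e z π₁ π₂)).trans hU
      -- the trace argument: `|insert z (π₁ ∪ π₂)| ≤ 3` with `z ∉ π₁` gives `π₂ ⊆ insert z π₁`
      have hsub : ∀ (hz : z ∉ π₁), (insert z (π₁ ∪ π₂)).card ≤ 3 → π₂ ⊆ insert z π₁ := by
        intro hz hT
        have h1 : (insert z π₁).card = 3 := by rw [card_insert_of_notMem hz, hπ2₁]
        have h2 : insert z π₁ ⊆ insert z (π₁ ∪ π₂) := insert_subset_insert z subset_union_left
        have h3 : insert z π₁ = insert z (π₁ ∪ π₂) := eq_of_subset_of_card_le h2 (by omega)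
        intro w hw
        rw [h3]; exact mem_insert_of_mem (mem_union_right _ hw)
      by_cases hO₁ : ∃ t ∈ X \ π₁, rk N (insert t (insert e π₁)) = 3 ∧ rk N {e, f, t} = 3 ∧
          rk N (X.erase t) = 4 ∧ rk N (insert b (insert b' {e, f, t})) = 5
      · obtain ⟨hz₁mem, hz₁H⟩ := hopp W₁ hO₁
        rw [← hzdef] at hz₁mem hz₁H
        have hzπ₁ : z ∉ π₁ := (mem_sdiff.1 hz₁mem).2
        by_cases hO₂ : ∃ t ∈ X \ π₂, rk N (insert t (insert e π₂)) = 3 ∧ rk N {e, f, t} = 3 ∧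
            rk N (X.erase t) = 4 ∧ rk N (insert b (insert b' {e, f, t})) = 5
        · -- (opposite, opposite)
          obtain ⟨hz₂mem, hz₂H⟩ := hopp W₂ hO₂
          rw [← hzz] at hz₂mem hz₂H
          have hT := htrace (hsame hz₁H hz₂H)
          have h1 := hsub hzπ₁ hT
          have hzπ₂ : z ∉ π₂ := (mem_sdiff.1 hz₂mem).2
          have h2 : π₂ ⊆ π₁ := fun w hw => (mem_insert.1 (h1 hw)).elim (fun h' => absurd (h' ▸ hw) hzπ₂) id
          exact hππ (eq_of_subset_of_card_le h2 (by omega)).symm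
        · -- (opposite, endpoint)
          have hzπ₂ : z ∈ π₂ := by rw [hzz]; exact hend W₂ hO₂ hex₂
          have hz₂H : rk N (insert z (insert e π₂)) = 3 := by rw [insert_eq_of_mem (mem_insert_of_mem hzπ₂)]; exact hYr₂
          have hU := hsame hz₁H hz₂H
          have hT := htrace hU
          have h1 := hsub hzπ₁ hT
          -- `π₂ = {z, y}` with `y ∈ π₁`, and `x` the other point of `π₁`
          have hc1 : (π₂.erase z).card = 1 := by rw [card_erase_of_mem hzπ₂, hπ2₂]
          obtain ⟨y, hy⟩ := card_eq_one.1 hc1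
          have hyπ₂ : y ∈ π₂.erase z := hy ▸ mem_singleton_self y
          have hyz : y ≠ z := (mem_erase.1 hyπ₂).1
          have hyπ₁ : y ∈ π₁ := (mem_insert.1 (h1 (mem_of_mem_erase hyπ₂))).elim (fun h' => absurd h' hyz) id
          have hπ₂eq : π₂ = {z, y} := by rw [← insert_erase hzπ₂, hy]
          have hc2 : (π₁.erase y).card = 1 := by rw [card_erase_of_mem hyπ₁, hπ2₁]
          obtain ⟨x, hx⟩ := card_eq_one.1 hc2
          have hxπ₁' : x ∈ π₁.erase y := hx ▸ mem_singleton_self x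
          have hxy : x ≠ y := (mem_erase.1 hxπ₁').1
          have hxπ₁ : x ∈ π₁ := mem_of_mem_erase hxπ₁'
          have hπ₁eq : π₁ = {x, y} := by rw [← insert_erase hyπ₁, hx]; exact pair_comm' y x
          have hxz : x ≠ z := fun h' => hzπ₁ (h' ▸ hxπ₁)
          have hxX : x ∈ X := hπ₁ hxπ₁
          have hxπ₂ : x ∉ π₂ := by rw [hπ₂eq]; simp only [mem_insert, mem_singleton, not_or]; exact ⟨hxz, hxy⟩
          have hxH : rk N (insert x (insert e π₂)) = 3 := by
            have h2 : rk N (insert x (insert e π₂)) ≤ rk N (insert z (insert e π₁) ∪ insert e π₂) :=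
              rk_mono' (M := N) (insert_x_subset_union hxπ₁)
            have h3 : rk N (insert e π₂) ≤ rk N (insert x (insert e π₂)) := rk_mono' (M := N) (subset_insert _ _)
            have h4 : rk N (insert z (insert e π₁) ∪ insert e π₂) ≤
                rk N (insert z (insert e π₁) ∪ insert z (insert e π₂)) := rk_mono' (M := N)
              (union_subset_union_right (subset_insert _ _))
            omega
          have hS3x : rk N (insert z ((X \ π₂).erase x)) = 3 := by
            rw [hπ₂eq, insert_sdiff_erase_eq hz₁X hxz.symm hyz.symm, ← hπ₁eq]
            exact d0_S3 h hn he hf hef heb heb' hfb hfb' _ hπ₁ hπ2₁ hYc₁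
          have hconx : rk N (insert b (insert b' (insert z ((X \ π₂).erase x)))) = 4 := by
            rw [hπ₂eq, insert_sdiff_erase_eq hz₁X hxz.symm hyz.symm, ← hπ₁eq]; exact hcon₁
          obtain ⟨h5, h6, h7⟩ := third_in_coff h hn hR hnle he hf hef heb heb' hfb hfb' hE7 he1 hX hπ₂ hπ2₂ hYr₂ hYon₂
            hf4₂ hYc₂ hcon₂ hR0₂ (mem_sdiff.2 ⟨hxX, hxπ₂⟩) hxH hzπ₂ hS3x hconx
          exact hO₂ ⟨x, mem_sdiff.2 ⟨hxX, hxπ₂⟩, hxH, h5, h6, h7⟩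
      · have hzπ₁ : z ∈ π₁ := hend W₁ hO₁ hex₁
        have hz₁H : rk N (insert z (insert e π₁)) = 3 := by rw [insert_eq_of_mem (mem_insert_of_mem hzπ₁)]; exact hYr₁
        by_cases hO₂ : ∃ t ∈ X \ π₂, rk N (insert t (insert e π₂)) = 3 ∧ rk N {e, f, t} = 3 ∧
            rk N (X.erase t) = 4 ∧ rk N (insert b (insert b' {e, f, t})) = 5
        · -- (endpoint, opposite): symmetric
          obtain ⟨hz₂mem, hz₂H⟩ := hopp W₂ hO₂
          rw [← hzz] at hz₂mem hz₂H
          have hzπ₂ : z ∉ π₂ := (mem_sdiff.1 hz₂mem).2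
          have hU := hsame hz₁H hz₂H
          have hU' : rk N (insert z (insert e π₂) ∪ insert z (insert e π₁)) ≤ 3 := by rw [union_comm]; exact hU
          have hT : (insert z (π₂ ∪ π₁)).card ≤ 3 := by
            rw [union_comm]; exact htrace hU
          have h1 : π₁ ⊆ insert z π₂ := by
            have h1' : (insert z π₂).card = 3 := by rw [card_insert_of_notMem hzπ₂, hπ2₂]
            have h2 : insert z π₂ ⊆ insert z (π₂ ∪ π₁) := insert_subset_insert z subset_union_left
            have h3 : insert z π₂ = insert z (π₂ ∪ π₁) := eq_of_subset_of_card_le h2 (by omega)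
            intro w hw
            rw [h3]; exact mem_insert_of_mem (mem_union_right _ hw)
          have hc1 : (π₁.erase z).card = 1 := by rw [card_erase_of_mem hzπ₁, hπ2₁]
          obtain ⟨y, hy⟩ := card_eq_one.1 hc1
          have hyπ₁ : y ∈ π₁.erase z := hy ▸ mem_singleton_self y
          have hyz : y ≠ z := (mem_erase.1 hyπ₁).1
          have hyπ₂ : y ∈ π₂ := (mem_insert.1 (h1 (mem_of_mem_erase hyπ₁))).elim (fun h' => absurd h' hyz) id
          have hπ₁eq : π₁ = {z, y} := by rw [← insert_erase hzπ₁, hy]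
          have hc2 : (π₂.erase y).card = 1 := by rw [card_erase_of_mem hyπ₂, hπ2₂]
          obtain ⟨x, hx⟩ := card_eq_one.1 hc2
          have hxπ₂' : x ∈ π₂.erase y := hx ▸ mem_singleton_self x
          have hxy : x ≠ y := (mem_erase.1 hxπ₂').1
          have hxπ₂ : x ∈ π₂ := mem_of_mem_erase hxπ₂'
          have hπ₂eq : π₂ = {x, y} := by rw [← insert_erase hyπ₂, hx]; exact pair_comm' y x
          have hxz : x ≠ z := fun h' => hzπ₂ (h' ▸ hxπ₂)
          have hxX : x ∈ X := hπ₂ hxπ₂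
          have hxπ₁ : x ∉ π₁ := by rw [hπ₁eq]; simp only [mem_insert, mem_singleton, not_or]; exact ⟨hxz, hxy⟩
          have hxH : rk N (insert x (insert e π₁)) = 3 := by
            have h2 : rk N (insert x (insert e π₁)) ≤ rk N (insert z (insert e π₂) ∪ insert e π₁) :=
              rk_mono' (M := N) (insert_x_subset_union hxπ₂)
            have h3 : rk N (insert e π₁) ≤ rk N (insert x (insert e π₁)) := rk_mono' (M := N) (subset_insert _ _)
            have h4 : rk N (insert z (insert e π₂) ∪ insert e π₁) ≤
                rk N (insert z (insert e π₂) ∪ insert z (insert e π₁)) := rk_mono' (M := N)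
              (union_subset_union_right (subset_insert _ _))
            omega
          have hS3x : rk N (insert z ((X \ π₁).erase x)) = 3 := by
            rw [hπ₁eq, insert_sdiff_erase_eq hz₁X hxz.symm hyz.symm, ← hπ₂eq]
            exact d0_S3 h hn he hf hef heb heb' hfb hfb' _ hπ₂ hπ2₂ hYc₂
          have hconx : rk N (insert b (insert b' (insert z ((X \ π₁).erase x)))) = 4 := by
            rw [hπ₁eq, insert_sdiff_erase_eq hz₁X hxz.symm hyz.symm, ← hπ₂eq]; exact hcon₂
          obtain ⟨h5, h6, h7⟩ := third_in_coff h hn hR hnle he hf hef heb heb' hfb hfb' hE7 he1 hX hπ₁ hπ2₁ hYr₁ hYon₁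
            hf4₁ hYc₁ hcon₁ hR0₁ (mem_sdiff.2 ⟨hxX, hxπ₁⟩) hxH hzπ₁ hS3x hconx
          exact hO₁ ⟨x, mem_sdiff.2 ⟨hxX, hxπ₁⟩, hxH, h5, h6, h7⟩
        · -- (endpoint, endpoint)
          have hzπ₂ : z ∈ π₂ := by rw [hzz]; exact hend W₂ hO₂ hex₂
          have hz₂H : rk N (insert z (insert e π₂)) = 3 := by rw [insert_eq_of_mem (mem_insert_of_mem hzπ₂)]; exact hYr₂
          have hU := hsame hz₁H hz₂H
          have hc1 : (π₁.erase z).card = 1 := by rw [card_erase_of_mem hzπ₁, hπ2₁]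
          have hc2 : (π₂.erase z).card = 1 := by rw [card_erase_of_mem hzπ₂, hπ2₂]
          obtain ⟨y₁, hy₁⟩ := card_eq_one.1 hc1
          obtain ⟨y₂, hy₂⟩ := card_eq_one.1 hc2
          have hy₁π : y₁ ∈ π₁.erase z := hy₁ ▸ mem_singleton_self y₁
          have hy₂π : y₂ ∈ π₂.erase z := hy₂ ▸ mem_singleton_self y₂
          have hπ₁eq : π₁ = {z, y₁} := by rw [← insert_erase hzπ₁, hy₁]
          have hπ₂eq : π₂ = {z, y₂} := by rw [← insert_erase hzπ₂, hy₂]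
          have hyy : y₁ ≠ y₂ := fun h' => hππ (by rw [hπ₁eq, hπ₂eq, h'])
          have hy₁X : y₁ ∈ X := hπ₁ (mem_of_mem_erase hy₁π)
          have hy₂X : y₂ ∈ X := hπ₂ (mem_of_mem_erase hy₂π)
          have hy₂z : y₂ ≠ z := (mem_erase.1 hy₂π).1
          have hcon₁' : rk N (insert b (insert b' (X \ {z, y₁}))) = 4 := by rw [← hπ₁eq]; exact hcon₁
          have hcon₂' : rk N (insert b (insert b' (X \ {z, y₂}))) = 4 := by rw [← hπ₂eq]; exact hcon₂
          obtain ⟨hW2, hWon⟩ := on_line_of_two_endpoints h hR hyy hy₁X hy₂X hcon₁' hcon₂' hz4₁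
          have hy₂H : rk N (insert y₂ (insert e π₁)) = 3 := by
            have h2 : rk N (insert y₂ (insert e π₁)) ≤ rk N (insert z (insert e π₁) ∪ insert z (insert e π₂)) :=
              rk_mono' (M := N) (insert_y_subset_union (mem_of_mem_erase hy₂π))
            have h3 : rk N (insert e π₁) ≤ rk N (insert y₂ (insert e π₁)) := rk_mono' (M := N) (subset_insert _ _)
            omega
          have hy₂π₁ : y₂ ∉ π₁ := by
            rw [hπ₁eq]; simp only [mem_insert, mem_singleton, not_or]; exact ⟨hy₂z, hyy.symm⟩
          have hW2' : rk N ((X \ π₁).erase y₂) = 2 := by rw [hπ₁eq, sdiff_pair_erase_eq]; exact hW2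
          have hWon' : rk N (insert b (insert b' ((X \ π₁).erase y₂))) = 3 := by
            rw [hπ₁eq, sdiff_pair_erase_eq]; exact hWon
          obtain ⟨h5, h6, h7⟩ := opp_in_coff_of_on_line h hn hR hnle he hf hef heb heb' hfb hfb' hE7 he1 hX hπ₁ hπ2₁
            hYr₁ hYon₁ hf4₁ hYc₁ hcon₁ hR0₁ (mem_sdiff.2 ⟨hy₂X, hy₂π₁⟩) hy₂H hW2' hWon'
          exact hO₁ ⟨y₂, mem_sdiff.2 ⟨hy₂X, hy₂π₁⟩, hy₂H, h5, h6, h7⟩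

end StarSharpD0O

end PercRepro.Cogirth
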